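import Summits.QuantumAdvantage.QuantumAdvantage.Theorems.CubicForrelationNearExactIsExactTwelveTypeO960At929
import Summits.QuantumAdvantage.QuantumAdvantage.Theorems.CubicForrelationNearExactIsExactTwelveTypeO512At929

/-!
# Crux `CubicForrelation.NearExactIsExact` (stmt-QuantumAdvantage-14043) — n = 12: NO type-O side at `Φ ≥ 929/1024`
  (base `992` with excess `≤ 128` dies by the wild-function argument; bases `512`, `960` by …TypeO512At929, …TypeO960At929)

Certificate seat `b2b-cforr-cert` (gen 20).  HONEST FRAMING: kernel-checked theorems (standard axioms) about cubic Boolean pairs on 12 bits — the type-O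
third of the value `929/1024` on the `n = 12` ladder (level 5: …TwelveLevelFive929Reduction + …TypeO512At929; level `≥ 6` × level `≥ 6`:
…TwelveLevelSixBothGe929).  NO new value of `θ₁₂` by itself.  NOT summit progress.

* `to20_typeO_E992_ge929_false`: `#E = 992`, `Φ ≥ 929/1024` is impossible: at `Φ ≥ 930/1024` by `to20_typeO_ge930_false`; below, the excess
  `X = Σ τ² − 12032 ≤ 128` gives `Σ v² ≤ 8` for the wild function (`u − 4(−1)^f = τ₀ + 8v`), the partner identity with the wild term and the
  character sums of `E` (`992` at `0`, `≡ 0 (mod 32)` elsewhere, `to20_char_sum_E992`) give `v̂ = 8k` with `k ≡ u_f (mod 2)`; `u_f` odd would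
  make `Σ k² ≥ 4096 > 64·8`, so `k` is even, `|k| ≤ Σ|v|/8 ≤ 1`, `k ≡ 0`, `v ≡ 0`, `X = 0`, `Φ = 930/1024` — contradiction.
* `to20_typeO_ge929_false`: with `to19_typeO_gt2932_shape` (base `512`, `960` or `992`) no type-O side exists at `Φ ≥ 929/1024`.

References: Kasami–Tokura (1970); MacWilliams–Sloane (1977) Ch. 14–15; Carlet (2021) §5.2; O'Donnell (2014) §1.4, §3.3.  Axioms: the standard three.
-/

set_option linter.dupNamespace false -- D-0017: single-problem summit ⇒ `QuantumAdvantage.QuantumAdvantage` by design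

noncomputable section

namespace Summit.QuantumAdvantage.QuantumAdvantage.Theorems.CubicForrelation.NearExactIsExact

open Finset
open Literature.Computability.QuantumComplexity
open Literature.Computability.QuantumComplexity.BuzetChailloux (bxor zeroVec bxor_bxor_cancel_left bxor_zeroVec zeroVec_bxor bxor_comm
  bxor_self twist_zeroVec_right twist_bxor_right)
open Literature.Computability.QuantumComplexity.DerivativeWalsh (W sum_W_sq)
open Literature.Computability.QuantumComplexity.Simon (twist_eq_one_or)
open Summit.QuantumAdvantage.QuantumAdvantage.Theorems.NearExactIsExact.Negative (TypeOTwelve.typeO_of_exists_odd)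

/-! ### A second wild-function engine: `Σ v² ≤ 8`, `k ≡ u_f (mod 2)` -/

/-- **Wild-function engine, small-excess form.**  `f` cubic on 12 bits with `W_f = 16·u_f`, an integer function `v` with `Σ v² ≤ 8` and
`v̂(y) = 8k(y)`, `k(y) ≡ u_f(y) (mod 2)` for all `y`: then `v ≡ 0`. [this work] -/
theorem to20_wild_engine_small (f : (Fin (6 + 6) → Bool) → Bool) (hf : IsDegLeFun 3 f)
    (uf : (Fin (6 + 6) → Bool) → ℤ) (huf : ∀ y, W (fun x => signOf (f x)) y = (2 : ℝ) ^ 4 * (uf y : ℝ))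
    (v : (Fin (6 + 6) → Bool) → ℤ) (hV : ∑ x, v x ^ 2 ≤ 8)
    (k : (Fin (6 + 6) → Bool) → ℤ) (hk : ∀ y, ∑ x, (v x : ℝ) * twist x y = 8 * (k y : ℝ)) (hk2 : ∀ y, (2 : ℤ) ∣ k y + uf y) :
    ∀ x, v x = 0 := by
  classical
  have hpars : ∑ y, (∑ x, (v x : ℝ) * twist x y) ^ 2 = 4096 * ∑ x, ((v x : ℝ)) ^ 2 := by
    have h := sum_W_sq (n := 6 + 6) (fun x => (v x : ℝ))
    unfold W at h
    rw [h]; norm_num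
  have hV' : ∑ x, ((v x : ℝ)) ^ 2 ≤ 8 := by
    have : ((∑ x, v x ^ 2 : ℤ) : ℝ) ≤ 8 := by exact_mod_cast hV
    push_cast at this; exact this
  have hk2sum : ∑ y, ((k y : ℝ)) ^ 2 ≤ 512 := by
    have e : ∑ y, (∑ x, (v x : ℝ) * twist x y) ^ 2 = 64 * ∑ y, ((k y : ℝ)) ^ 2 := by
      rw [mul_sum]; exact sum_congr rfl fun y _ => by rw [hk y]; ring
    rw [e] at hpars
    nlinarith
  have hkabs : ∀ y, |k y| ≤ 1 := by
    intro y
    have h1 : |∑ x, (v x : ℝ) * twist x y| ≤ 8 := by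
      calc |∑ x, (v x : ℝ) * twist x y| ≤ ∑ x, |(v x : ℝ) * twist x y| := abs_sum_le_sum_abs _ _
        _ = ∑ x, |(v x : ℝ)| := sum_congr rfl fun x _ => by
            rw [abs_mul]; rcases twist_eq_one_or x y with h | h <;> rw [h] <;> simp
        _ ≤ ∑ x, ((v x : ℝ)) ^ 2 := sum_le_sum fun x _ => by
            rw [← Int.cast_abs]
            have habs : |v x| ≤ v x ^ 2 := by
              rcases le_or_gt 0 (v x) with h | h
              · rw [abs_of_nonneg h]; nlinarith
              · rw [abs_of_neg h]; nlinarith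
            exact_mod_cast habs
        _ ≤ 8 := hV'
    rw [hk y, abs_mul, abs_of_nonneg (by norm_num : (0:ℝ) ≤ 8)] at h1
    have : |(k y : ℝ)| ≤ 1 := by linarith
    rw [← Int.cast_abs] at this
    exact_mod_cast this
  by_cases hO : ∃ y, Odd (uf y)
  · exfalso
    obtain ⟨y₁, hy₁⟩ := hO
    have hdeg := stub_walshTower stub_axParity (6 + 6) 4 0 f uf hf huf (by intro j hj hjn; omega)
    have hallodd : ∀ y, Odd (uf y) := by
      intro y
      have h := tc_const_of_deg_zero hdeg y y₁
      have h1 : decide (Odd (uf y₁)) = true := by simpa using hy₁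
      rw [h1] at h
      simpa using h
    have hk1 : ∀ y, (1 : ℝ) ≤ ((k y : ℝ)) ^ 2 := by
      intro y
      obtain ⟨j, hj⟩ := hk2 y
      have h0 := Int.odd_iff.1 (hallodd y)
      have : k y ≤ -1 ∨ 1 ≤ k y := by omega
      have hsq := tp_sq_ge (k := 1) (by norm_num) this
      exact_mod_cast hsq
    have h1 : ∑ y, (1 : ℝ) ≤ ∑ y, ((k y : ℝ)) ^ 2 := sum_le_sum fun y _ => hk1 y
    rw [sum_const, card_univ, Fintype.card_fun, Fintype.card_bool, Fintype.card_fin] at h1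
    norm_num at h1
    linarith
  · push Not at hO
    have hk0 : ∀ y, k y = 0 := by
      intro y
      obtain ⟨j, hj⟩ := hk2 y
      have hev := Int.not_odd_iff_even.1 (hO y)
      obtain ⟨i, hi⟩ := hev
      have h3 := hkabs y
      rw [abs_le] at h3
      omega
    have hvhat0 : ∑ y, (∑ x, (v x : ℝ) * twist x y) ^ 2 = 0 :=
      sum_eq_zero fun y _ => by rw [hk y, hk0 y]; norm_num
    rw [hpars] at hvhat0
    have hsum0 : ∑ x, ((v x : ℝ)) ^ 2 = 0 := by linarith
    intro x
    have := (sum_eq_zero_iff_of_nonneg fun z _ => sq_nonneg ((v z : ℝ))).1 hsum0 x (mem_univ x)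
    exact_mod_cast pow_eq_zero_iff two_ne_zero |>.1 this

/-! ### Base set `992` at `Φ ≥ 929/1024` -/

/-- **No type-O side with base set `992` at `Φ ≥ 929/1024`** (12 bits).  See the module docstring.  Finite-slice statement, NOT summit
progress. [this work] -/
theorem to20_typeO_E992_ge929_false (f g : (Fin (6 + 6) → Bool) → Bool) (hf : IsDegLeFun 3 f) (hg : IsDegLeFun 3 g)
    (u : (Fin (6 + 6) → Bool) → ℤ) (hu : ∀ x, W (fun y => signOf (g y)) x = (2 : ℝ) ^ 4 * (u x : ℝ))
    (hodd : ∃ x, Odd (u x)) (hE : #(univ.filter fun x : Fin (6 + 6) → Bool => (Odd (u x / 2) ↔ Odd (u x / 2 / 2))) = 992)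
    (hΦ : (929 / 1024 : ℝ) ≤ forrelation f g) : False := by
  classical
  by_cases h930 : (930 / 1024 : ℝ) ≤ forrelation f g
  · exact to20_typeO_ge930_false f g hf hg u hu hodd h930
  push Not at h930
  have hall : ∀ x, Odd (u x) := TypeOTwelve.typeO_of_exists_odd g u hg hu hodd
  have hu' : ∀ x, W (fun y => signOf (g y)) x = (2 : ℝ) ^ (2 * 2) * (u x : ℝ) := fun x => (hu x).trans (by norm_num)
  have hd1 : IsDegLeFun 1 (fun x => decide (Odd (u x / 2))) := z2_digitOne 2 g u hg hu' hall
  have hd2 : IsDegLeFun 3 (fun x => decide (Odd (u x / 2 / 2))) := z2_digitTwo 2 g u hg hu' hall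
  obtain ⟨c₁, b₁, hcb⟩ := stub_affineForm (6 + 6) _ hd1
  set E := univ.filter (fun x : Fin (6 + 6) → Bool => (Odd (u x / 2) ↔ Odd (u x / 2 / 2))) with hEdef
  have hdegE : IsDegLeFun (2 + 1) (fun x => (decide (Odd (u x / 2)) ^^ decide (Odd (u x / 2 / 2))) ^^ true) :=
    tb_isDegLeFun_xor_const (bb_isDegLeFun_bxor (hd1.mono (by norm_num)) hd2) true
  have hsetE : (univ.filter fun x : Fin (6 + 6) → Bool =>
      ((decide (Odd (u x / 2)) ^^ decide (Odd (u x / 2 / 2))) ^^ true) = true) = E := by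
    rw [hEdef]
    apply filter_congr
    intro x _
    by_cases h1 : Odd (u x / 2) <;> by_cases h2 : Odd (u x / 2 / 2) <;> simp [h1, h2]
  -- budget
  obtain ⟨-, -, hbud⟩ := to19_typeO_gt2932_shape f g hf hg u hu hodd (by linarith)
  have hT : (∑ x, (u x - 4 * sZ (f x)) ^ 2 : ℤ) ≤ 12160 := by
    have h' : ((∑ x, (u x - 4 * sZ (f x)) ^ 2 : ℤ) : ℝ) ≤ 12160 := by rw [hbud]; linarith
    exact_mod_cast h'
  choose v hv using fun x => to12_pt_mod8 (u x) (sZ (f x)) (hall x) (tp_sZ_cases (f x))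
  set τ₀ : (Fin (6 + 6) → Bool) → ℤ := fun x =>
    sZ (decide (Odd (u x / 2))) * (1 - 4 * (if (Odd (u x / 2) ↔ Odd (u x / 2 / 2)) then 1 else 0)) with hτ₀def
  have hτ₀val : ∀ x, τ₀ x = 1 ∨ τ₀ x = -1 ∨ τ₀ x = 3 ∨ τ₀ x = -3 := by
    intro x
    simp only [τ₀]
    rcases tp_sZ_cases (decide (Odd (u x / 2))) with h | h <;> rw [h] <;> split_ifs <;> norm_num
  have hτ₀sq : ∀ x, τ₀ x ^ 2 = 1 + 8 * (if (Odd (u x / 2) ↔ Odd (u x / 2 / 2)) then 1 else 0 : ℤ) := by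
    intro x
    simp only [τ₀]
    rcases tp_sZ_cases (decide (Odd (u x / 2))) with h | h <;> rw [h] <;> split_ifs <;> norm_num
  have hsumE : (∑ x, (if (Odd (u x / 2) ↔ Odd (u x / 2 / 2)) then 1 else 0 : ℤ)) = #E := by rw [sum_boole]
  have hsumτ₀ : ∑ x, τ₀ x ^ 2 = 12032 := by
    rw [sum_congr rfl fun x _ => hτ₀sq x, sum_add_distrib, ← mul_sum, hsumE, sum_const, card_univ, Fintype.card_fun,
      Fintype.card_bool, Fintype.card_fin, hE]
    norm_num
  have hX16 : ∀ x, 16 * v x ^ 2 ≤ (τ₀ x + 8 * v x) ^ 2 - τ₀ x ^ 2 := by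
    intro x
    have ht : -3 ≤ τ₀ x ∧ τ₀ x ≤ 3 := by rcases hτ₀val x with h | h | h | h <;> rw [h] <;> norm_num
    have key : 0 ≤ v x * (3 * v x + τ₀ x) := by
      rcases lt_trichotomy (v x) 0 with hlt | heq | hgt
      · have h1 : 3 * v x + τ₀ x ≤ 0 := by linarith
        nlinarith
      · rw [heq]; simp
      · have h1 : 0 ≤ 3 * v x + τ₀ x := by linarith
        exact mul_nonneg hgt.le h1
    nlinarith [key]
  have hV : ∑ x, v x ^ 2 ≤ 8 := by
    have hTdec : (∑ x, (u x - 4 * sZ (f x)) ^ 2 : ℤ) = ∑ x, τ₀ x ^ 2 + ∑ x, ((τ₀ x + 8 * v x) ^ 2 - τ₀ x ^ 2) := by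
      rw [← sum_add_distrib]; exact sum_congr rfl fun x _ => by rw [hv x]; ring
    have h1 : 16 * ∑ x, v x ^ 2 ≤ ∑ x, ((τ₀ x + 8 * v x) ^ 2 - τ₀ x ^ 2) := by
      rw [mul_sum]; exact sum_le_sum fun x _ => hX16 x
    linarith
  -- the partner and the wild identity
  obtain ⟨uf, huf⟩ := tw_base (n := 6 + 6) f hf 4 (by norm_num)
  have hid : ∀ y, 64 * (uf y : ℝ) = 256 * signOf (g y) -
      signOf b₁ * ((if bxor c₁ y = (fun _ => false) then (2 : ℝ) ^ (6 + 6) else 0) - 4 * ∑ x ∈ E, twist x (bxor c₁ y)) -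
      8 * ∑ x, (v x : ℝ) * twist x y := by
    intro y
    have h := to18_typeO_partner_identity f g u hu v hv c₁ b₁ hcb uf huf y
    rw [← hEdef] at h
    exact h
  have hsb : ((sZ b₁ : ℤ) : ℝ) = signOf b₁ := tp_sZ_cast _
  have hk : ∀ y, ∃ k : ℤ, (∑ x, (v x : ℝ) * twist x y) = 8 * (k : ℝ) ∧ (2 : ℤ) ∣ k + uf y := by
    intro y
    have h := hid y
    by_cases hz : bxor c₁ y = (fun _ => false)
    · rw [if_pos hz] at h
      have hS : ∑ x ∈ E, twist x (bxor c₁ y) = 992 := by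
        rw [hz, show (fun _ : Fin (6 + 6) => false) = (zeroVec : Fin (6 + 6) → Bool) from rfl,
          sum_congr rfl fun x _ => twist_zeroVec_right x, sum_const]
        rw [show #E = 992 from hE]; norm_num
      rw [hS] at h
      refine ⟨4 * sZ (g y) - 2 * sZ b₁ - uf y, ?_, ⟨2 * sZ (g y) - sZ b₁, by ring⟩⟩
      push_cast; rw [tp_sZ_cast, hsb]
      have e : ((2 : ℝ) ^ (6 + 6) - 4 * 992) = 128 := by norm_num
      rw [e] at h
      linarith
    · rw [if_neg hz] at h
      obtain ⟨i₀, hi₀⟩ : ∃ i₀, bxor c₁ y i₀ = true := by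
        by_contra hn
        push Not at hn
        exact hz (funext fun i => by simpa using hn i)
      obtain ⟨m, hm⟩ := to20_char_sum_E992 _ hdegE (by rw [hsetE]; exact hE) (bxor c₁ y) i₀ hi₀
      rw [hsetE] at hm
      rw [hm] at h
      refine ⟨4 * sZ (g y) + 2 * sZ b₁ * m - uf y, ?_, ⟨2 * sZ (g y) + sZ b₁ * m, by ring⟩⟩
      push_cast; rw [tp_sZ_cast, hsb]
      linarith
  choose k hk8 hk2 using hk
  have hv0 := to20_wild_engine_small f hf uf huf v hV k hk8 hk2
  have hTeq : (∑ x, (u x - 4 * sZ (f x)) ^ 2 : ℤ) = 12032 := by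
    rw [← hsumτ₀]; exact sum_congr rfl fun x _ => by rw [hv x, hv0 x]; ring
  have h : ((∑ x, (u x - 4 * sZ (f x)) ^ 2 : ℤ) : ℝ) = 12032 := by exact_mod_cast hTeq
  rw [hbud] at h
  linarith

/-! ### No type-O side at `Φ ≥ 929/1024` -/

/-- **No type-O side at `Φ ≥ 929/1024` on 12 bits**: the base set would be `512` (…TypeO512At929), `960` (…TypeO960At929) or `992`
(`to20_typeO_E992_ge929_false`).  Finite-slice statement, NOT summit progress. [this work] -/
theorem to20_typeO_ge929_false (f g : (Fin (6 + 6) → Bool) → Bool) (hf : IsDegLeFun 3 f) (hg : IsDegLeFun 3 g)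
    (u : (Fin (6 + 6) → Bool) → ℤ) (hu : ∀ x, W (fun y => signOf (g y)) x = (2 : ℝ) ^ 4 * (u x : ℝ))
    (hodd : ∃ x, Odd (u x)) (hΦ : (929 / 1024 : ℝ) ≤ forrelation f g) : False := by
  obtain ⟨hshape, -, -⟩ := to19_typeO_gt2932_shape f g hf hg u hu hodd (by linarith)
  rcases hshape with ⟨h512, -⟩ | h960 | ⟨h992, -⟩
  · exact to20_typeO_E512_ge929_false f g hf hg u hu hodd h512 hΦ
  · exact to20_typeO_E960_ge929_false f g hf hg u hu hodd h960 hΦ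
  · exact to20_typeO_E992_ge929_false f g hf hg u hu hodd h992 hΦ

/-- **Packaging at `Fin 12`.** [this work] -/
theorem typeO_ge_929_false_twelve : ∀ f g : (Fin 12 → Bool) → Bool, IsDegLeFun 3 f → IsDegLeFun 3 g →
    ∀ u : (Fin 12 → Bool) → ℤ, (∀ x, W (fun y => signOf (g y)) x = 16 * (u x : ℝ)) → (∃ x, Odd (u x)) →
    (929 / 1024 : ℝ) ≤ forrelation f g → False :=
  fun f g hf hg u hu hodd hΦ => to20_typeO_ge929_false f g hf hg u (fun x => (hu x).trans (by norm_num)) hodd hΦ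

end Summit.QuantumAdvantage.QuantumAdvantage.Theorems.CubicForrelation.NearExactIsExact

end
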